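import Literature.NumberTheory.Automorphic.Liu2021.AlbaneseExistence
import Literature.NumberTheory.Automorphic.Liu2021.AlbaneseBaseChangeProduct
import Literature.NumberTheory.Automorphic.Liu2021.AlbaneseBaseChangeProductCompat
import Literature.NumberTheory.Automorphic.Liu2021.AlbaneseIsoCompat
import Literature.AlgebraicGeometry.Motives.AlbaneseExistenceSubfieldComplex
import HarnessLib

/-!
# The Albanese variety over a finite Galois splitting field is the product of the Albanese
# varieties of the (pointed) pieces — for ANY Albanese datum (Liu 2021, §2.1, proof of the Proposition)

[Liu2021] = Yifeng Liu, *Fourier–Jacobi cycles and arithmetic relative trace formula*, Camb. J. Math.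
**9** (2021) = arXiv:2102.11518; `l. NNNN` = lines of the TeX source `FJcycle.tex`, as in
`Liu2021/AppendixC/Glue.lean` (structure `AppendixC.Albanese X`, Def. 2.3 with the Proposition
l. 1190–1192: Liu's point-free Albanese datum `α_X : ∇X → Alb_X`).

The printed proof of the Proposition (l. 1194–1200) CONSTRUCTS `Alb_X` from a splitting field `k'`:
`X' = X_{k'} = ⊔ᵢ Xᵢ`, `Alb_{X'} = ∏ᵢ Alb_{Xᵢ}` (Serre's pointed Albanese varieties of the pieces),
and `Alb_X` by Galois descent, so that `(Alb_X)_{k'} ≅ ∏ᵢ Alb_{Xᵢ}`.  This file proves that LAST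
ISOMORPHISM for EVERY Albanese datum `a` of `X` (not only the constructed one), with `k'` a FINITE
Galois extension and the pieces POINTED:

* `Albanese.exists_isGalois_isLimit_fan_baseChange` — for `X` smooth of relative dimension `d` and
  projective over a field `k` of characteristic zero embeddable in `ℂ` and ANY `a : Albanese X`,
  there are a finite Galois extension `L / k`, a decomposition `X_L ≅ ∐_c E_c` (colimit cofan) into
  smooth projective geometrically irreducible `L`-varieties `E_c` with `L`-rational points `P_c`,
  Albanese data `𝒥_c : Motives.Jacobian (E c)` (Milne's difference-map form) and homomorphisms
  `π_c : Alb_X ×_k L ⟶ J(E_c)` forming a LIMIT FAN: `a.Alb ×_k L ≅ ∏_c J(E_c)`.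

Proof (all inputs are tree theorems): split `X` over a finite Galois `L` with pointed pieces
(`exists_isGalois_isColimit_isSmoothProjective_algPoints`, `Liu2021/SplittingField`); give the pieces
Albanese data (`Motives.nonempty_jacobian_of_isSmoothProjective_of_algebra_complex`, along a
`k`-embedding `L → ℂ`); assemble Liu's datum `a″` of `X_L` with `a″.Alb = ∏_c J(E_c)`
(`Albanese.exists_of_isColimit`, `Liu2021/AlbaneseBaseChangeProduct`); descend its `∇` and the datum
to `k` WITH the comparison isomorphism `a″.Alb ≅ a₀.Alb ×_k L`
(`Nabla.exists_of_nabla_baseChange`, `Albanese.exists_iso_baseChange_of_albanese_baseChange`); and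
compare `a` with `a₀` over `k` by uniqueness of corepresenting objects (`Albanese.nonempty_iso`,
`Liu2021/NablaOfPieces`), base-changing that isomorphism (`AbelianVariety.baseChangeFunctor`).  No
compatibility with the Albanese MORPHISMS is asserted (none is needed downstream).

Use (cell pub-hodgecm2, TEAM hComp): first half of de-citing the named fact
`Liu2021.albanese_baseChange` ([FGA VI 3.3 (iii)]) at its consumer, the `hAlb` binder of the COR-CM
`hComp` closer, in the jointly-epimorphic shape (`Liu2021/AlbaneseBaseChangeJointlyEpi`).  Everything
is proved; no definition, no named fact (D-0026).  HC_CM is NOT proved.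

## References

* [Liu2021] Y. Liu, arXiv:2102.11518 = Camb. J. Math. 9 (2021): §2.1 Def. 2.1 (l. 1171–1177),
  Proposition (l. 1190–1192) with proof (l. 1194–1200), Def. 2.3 (l. 1202–1208).
* [Milne1986JacobianVarieties] J. S. Milne, *Jacobian Varieties*, in Cornell–Silverman (1986):
  Remark 1.9, §6 Prop. 6.1, Prop. 6.4, Remark 6.5.
* [Serre1958MorphismesUniversels] J.-P. Serre, *Morphismes universels et variété d'Albanese*,
  Sém. Chevalley 4 (1958/59), exp. 10.
-/

noncomputable section

open CategoryTheory CategoryTheory.Limits AlgebraicGeometry MonoidalCategory CartesianMonoidalCategory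
open Literature.AlgebraicGeometry.Motives

namespace Literature.NumberTheory.Automorphic.Liu2021.AppendixC

open AbelianVariety (bcSpec bcFunctor)

set_option backward.isDefEq.respectTransparency false

/-- For a `∇X` (Def. 2.1 (1)) of `X` smooth of relative dimension `d` over `k` and a field extension
`L / k`: `(∇X)_L` is reduced (an open subscheme of `(X × X)_L`, which is smooth of relative dimension
`d + d` over `L`) and `∇X → Spec k` is locally of finite type — the hypotheses of the Galois descent
`Albanese.exists_iso_baseChange_of_albanese_baseChange` (twin of the private lemma of
`Liu2021/AlbaneseExistence`). [folklore] -/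
private theorem Nabla.isReduced_bc_and_locallyOfFiniteType' {k : Type} [Field k] (L : Type) [Field L] [Algebra k L]
    {d : ℕ} {X : SchemeOver k} [SmoothOfRelativeDimension d X.hom] (N : Nabla X) :
    IsReduced (GaloisDescent.bc L N.N) ∧ LocallyOfFiniteType N.N.hom := by
  haveI := N.isOpenImmersion_incl
  haveI := smoothOfRelativeDimension_isStableUnderBaseChange (n := d)
  haveI : SmoothOfRelativeDimension d (pullback.fst X.hom X.hom) :=
    MorphismProperty.pullback_fst _ _ ‹_›
  haveI : SmoothOfRelativeDimension (d + d) (X ⊗ X).hom := by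
    rw [Over.tensorObj_hom]; infer_instance
  haveI : SmoothOfRelativeDimension (d + d) ((bcFunctor k L).obj (X ⊗ X)).hom := by
    haveI := smoothOfRelativeDimension_isStableUnderBaseChange (n := d + d)
    exact MorphismProperty.pullback_snd _ _ ‹_›
  haveI : IsReduced ((bcFunctor k L).obj (X ⊗ X)).left :=
    isReduced_of_smoothOfRelativeDimension ((bcFunctor k L).obj (X ⊗ X)).hom (d + d)
  haveI := GaloisDescent.isOpenImmersion_bcFunctor_map_left L N.incl
  haveI : Smooth (X ⊗ X).hom := SmoothOfRelativeDimension.smooth (d + d) _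
  refine ⟨isReduced_of_isOpenImmersion ((bcFunctor k L).map N.incl).left, ?_⟩
  rw [← Over.w N.incl]
  infer_instance

/-- **[Liu2021, §2.1, proof of the Proposition] Over a finite Galois splitting field with pointed pieces,
the Albanese variety of ANY Albanese datum is the product of the Albanese varieties of the pieces.**
For `X` smooth of relative dimension `d` and projective over a field `k` of characteristic zero with
`[Algebra k ℂ]`, and any `a : Albanese X` (Def. 2.3): there are a finite Galois `L / k`, a finite
colimit cofan `e_c : E_c ⟶ X_L` of smooth projective geometrically irreducible `L`-varieties of
dimension `d` with rational points `P_c ∈ E_c(L)`, Albanese data `𝒥_c` of the `E_c` (Milne's form) and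
`π_c : a.Alb ×_k L ⟶ J(E_c)` with `(a.Alb ×_k L, π)` a LIMIT FAN — «`(Alb_X)_{k'} = Alb_{X'} = ∏ᵢ Alb_{Xᵢ}`»
(l. 1194–1200) for every datum, by uniqueness of the corepresenting object (l. 1203).  Ours; see the
module docstring for the chain of tree theorems.
[cite: Liu2021, §2.1 Proposition (FJcycle.tex l. 1190–1192) with proof (l. 1194–1200), Def. 2.3 (l. 1202–1208)]
[cite: Milne1986JacobianVarieties, Remark 1.9, §6 Prop. 6.4 and Remark 6.5] -/
theorem Albanese.exists_isGalois_isLimit_fan_baseChange {k : Type} [Field k] [CharZero k] [Algebra k ℂ]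
    {d : ℕ} (X : SchemeOver k) [SmoothOfRelativeDimension d X.hom] (hX : IsProjectiveOver X)
    (a : Albanese X) :
    ∃ (L : Type) (_ : Field L) (_ : Algebra k L) (_ : FiniteDimensional k L) (_ : IsGalois k L)
      (C : Type) (_ : Fintype C) (E : C → SchemeOver L) (e : ∀ c, E c ⟶ (bcFunctor k L).obj X)
      (_ : ∀ c, IsSmoothProjective d (E c)) (_ : Nonempty (IsColimit (Cofan.mk ((bcFunctor k L).obj X) e)))
      (_ : ∀ c, AlgPoints (E c) L) (𝒥 : ∀ c, Jacobian (E c)) (π : ∀ c, a.Alb.baseChange L ⟶ (𝒥 c).J),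
      Nonempty (IsLimit (Fan.mk (a.Alb.baseChange L) π)) := by
  -- split `X` over a finite Galois `L / k`, with pointed pieces
  obtain ⟨L, _, _, _, _, C, _, E, e, hE, hP, ⟨hcol⟩⟩ :=
    exists_isGalois_isColimit_isSmoothProjective_algPoints (d := d) X hX
  haveI : Fintype C := Fintype.ofFinite C
  -- Albanese data of the pieces, along a `k`-embedding `L → ℂ`
  letI : Algebra L ℂ := ((IsAlgClosed.lift : L →ₐ[k] ℂ) : L →+* ℂ).toAlgebra
  have 𝒥 : ∀ c, Jacobian (E c) := fun c =>
    (nonempty_jacobian_of_isSmoothProjective_of_algebra_complex (hE c)).some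
  -- Liu's datum of the split scheme `X_L`, with `Alb = ∏_c J(E_c)`
  obtain ⟨a'', π'', ⟨hlim''⟩⟩ :=
    Albanese.exists_of_isColimit hcol 𝒥 fun c => (hE c).geometricallyIrreducible
  -- descend `∇(X_L)` and the datum to `k`, keeping the comparison isomorphism
  obtain ⟨N, e', he'⟩ := Nabla.exists_of_nabla_baseChange L a''.nabla
  obtain ⟨h1, h2⟩ := Nabla.isReduced_bc_and_locallyOfFiniteType' L (d := d) N
  haveI := h1
  haveI := h2
  obtain ⟨a₀, -, ⟨i⟩⟩ := Albanese.exists_iso_baseChange_of_albanese_baseChange L N a'' e' he'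
  -- `a.Alb ≅ a₀.Alb` over `k` (uniqueness of the corepresenting object), base-changed to `L`
  obtain ⟨j⟩ := Albanese.nonempty_iso a a₀
  let θ : a.Alb.baseChange L ≅ a''.Alb := (AbelianVariety.baseChangeFunctor k L).mapIso j ≪≫ i.symm
  refine ⟨L, inferInstance, inferInstance, inferInstance, inferInstance, C, inferInstance, E, e, hE, ⟨hcol⟩,
    fun c => (hP c).some, 𝒥, fun c => θ.hom ≫ π'' c, ⟨?_⟩⟩
  exact IsLimit.ofIsoLimit hlim'' (Fan.ext θ.symm fun c => (θ.inv_hom_id_assoc (π'' c)).symm)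

/-! ## Appendix (cell hodgecm-mathlib, III-0 (G)-road, piece G4): the limit fan COMPATIBLE with the Albanese morphisms -/

/-- **[Liu2021, §2.1, proof of the Proposition] The `α`-COMPATIBLE finite-Galois Albanese fan** — piece G4 of the
(G)-road (cell `hodgecm-mathlib`, A-p18's carve), ASSEMBLY STEP with the three compatibility-enriched inputs taken
as HYPOTHESES `hG1` (the split datum with its biproduct structure and the restriction of `α` to the pieces exposed —
the enriched `Albanese.exists_of_isColimit`), `hG2` (Galois descent of the datum WITH the comparison isomorphisms of
`∇` and of `Alb` and their compatibility with `incl` and `α` — the enriched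
`Albanese.exists_iso_baseChange_of_albanese_baseChange`, fed by `Nabla.exists_of_nabla_baseChange_incl`) and `hG3`
(uniqueness of the corepresenting datum WITH the compatibility of the isomorphism with `∇` and `α` — the enriched
`Albanese.nonempty_iso`); they are discharged by name in `Albanese.exists_isGalois_isLimit_fan_baseChange_compat` below
(tree: `Albanese.exists_of_isColimit_compat`, `Albanese.exists_iso_baseChange_of_albanese_baseChange_compat_incl`,
`Albanese.exists_iso_compat`).
CONCLUSION (for `X` smooth of relative dimension `d` and projective over `k` of characteristic zero with `[Algebra k ℂ]`, and
ANY `a : Albanese X`): a finite Galois `L / k`, a colimit cofan `e_c : E_c ⟶ X_L` of pointed smooth projective pieces with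
Albanese data `𝒥_c` (Milne's difference-map form), and a BIPRODUCT presentation `π_c : Alb_X ×_k L ⟶ J(E_c)`,
`ι_c : J(E_c) ⟶ Alb_X ×_k L` (limit fan, `ι_c ≫ π_c = 𝟙`, `ι_c ≫ π_{c'} = 0`, `∑ π_c ≫ ι_c = 𝟙`) TOGETHER WITH morphisms
`l_c : E_c × E_c ⟶ (∇X)_L` over `(e_c × e_c) : E_c × E_c → X_L × X_L ≅ (X × X)_L` along which the base-changed Albanese morphism
`(α_X)_L` restricts to `diff_c ≫ ι_c` — «`(Alb_X)_{k'} = ∏ᵢ Alb_{Xᵢ}`» (l. 1194–1200) with the MORPHISMS matched.  Assembly: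
`θ := (φ_L) ≪≫ i⁻¹ : Alb_X ×_k L ≅ Alb(X_L)`, `π := θ ≫ π″`, `ι := ι″ ≫ θ⁻¹`, `l := l″ ≫ n⁻¹ ≫ (e₃⁻¹)_L`.  Ours.
[cite: Liu2021, §2.1 Proposition (FJcycle.tex l. 1190–1192) with proof (l. 1194–1200), Def. 2.3 (l. 1202–1208)]
[cite: Milne1986JacobianVarieties, Remark 1.9, §6 Prop. 6.4 and Remark 6.5] -/
private theorem Albanese.exists_isGalois_isLimit_fan_baseChange_compat_of_inputs
    (hG1 : ∀ {L : Type} [Field L] {X' : SchemeOver L} {κ : Type} [Fintype κ] {Y : κ → SchemeOver L}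
      {inj : ∀ c, Y c ⟶ X'} (_ : IsColimit (Cofan.mk X' inj)) (𝒥 : ∀ c, Jacobian (Y c))
      (_ : ∀ c, GeometricallyIrreducible (Y c).hom),
      ∃ (a : Albanese X') (π : ∀ c, a.Alb ⟶ (𝒥 c).J) (ι : ∀ c, (𝒥 c).J ⟶ a.Alb) (l : ∀ c, Y c ⊗ Y c ⟶ a.nabla.N),
        Nonempty (IsLimit (Fan.mk a.Alb π)) ∧ (∀ c, ι c ≫ π c = 𝟙 _) ∧ (∀ c c', c ≠ c' → ι c ≫ π c' = 0) ∧
        (∑ c, π c ≫ ι c = 𝟙 a.Alb) ∧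
        (∀ c, l c ≫ a.nabla.incl = inj c ⊗ₘ inj c) ∧ (∀ c, l c ≫ a.α = (𝒥 c).diff ≫ (ι c).hom.hom.hom))
    (hG2 : ∀ {k : Type} [Field k] (L : Type) [Field L] [Algebra k L] [FiniteDimensional k L] [IsGalois k L]
      {X : SchemeOver k} (N : Nabla X) [IsReduced (GaloisDescent.bc L N.N)] [LocallyOfFiniteType N.N.hom]
      (a : Albanese ((bcFunctor k L).obj X)) (e : (bcFunctor k L).obj N.N ≅ a.nabla.N)
      (_ : (bcFunctor k L).map N.diag ≫ e.hom = a.nabla.diag)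
      (_ : e.hom ≫ a.nabla.incl ≫ Functor.LaxMonoidal.μ (bcFunctor k L) X X = (bcFunctor k L).map N.incl),
      ∃ (a₀ : Albanese X) (n : (bcFunctor k L).obj a₀.nabla.N ≅ a.nabla.N) (i : a.Alb ≅ a₀.Alb.baseChange L),
        a₀.nabla = N ∧ (bcFunctor k L).map a₀.nabla.diag ≫ n.hom = a.nabla.diag ∧
        n.hom ≫ a.nabla.incl ≫ Functor.LaxMonoidal.μ (bcFunctor k L) X X = (bcFunctor k L).map a₀.nabla.incl ∧
        n.hom ≫ a.α ≫ i.hom.hom.hom.hom = (bcFunctor k L).map a₀.α)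
    (hG3 : ∀ {k : Type} [Field k] {X : SchemeOver k} (a₁ a₂ : Albanese X),
      ∃ (e : a₁.nabla.N ≅ a₂.nabla.N) (φ : a₁.Alb ≅ a₂.Alb),
        e.hom ≫ a₂.nabla.incl = a₁.nabla.incl ∧ a₁.nabla.diag ≫ e.hom = a₂.nabla.diag ∧
        a₁.α ≫ φ.hom.hom.hom.hom = e.hom ≫ a₂.α)
    {k : Type} [Field k] [CharZero k] [Algebra k ℂ]
    {d : ℕ} (X : SchemeOver k) [SmoothOfRelativeDimension d X.hom] (hX : IsProjectiveOver X) (a : Albanese X) :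
    ∃ (L : Type) (_ : Field L) (_ : Algebra k L) (_ : FiniteDimensional k L) (_ : IsGalois k L)
      (C : Type) (_ : Fintype C) (E : C → SchemeOver L) (e : ∀ c, E c ⟶ (bcFunctor k L).obj X)
      (_ : ∀ c, IsSmoothProjective d (E c)) (_ : Nonempty (IsColimit (Cofan.mk ((bcFunctor k L).obj X) e)))
      (_ : ∀ c, AlgPoints (E c) L) (𝒥 : ∀ c, Jacobian (E c))
      (π : ∀ c, a.Alb.baseChange L ⟶ (𝒥 c).J) (ι : ∀ c, (𝒥 c).J ⟶ a.Alb.baseChange L)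
      (l : ∀ c, E c ⊗ E c ⟶ (bcFunctor k L).obj a.nabla.N),
      Nonempty (IsLimit (Fan.mk (a.Alb.baseChange L) π)) ∧ (∀ c, ι c ≫ π c = 𝟙 _) ∧ (∀ c c', c ≠ c' → ι c ≫ π c' = 0) ∧
      (∑ c, π c ≫ ι c = 𝟙 _) ∧
      (∀ c, l c ≫ (bcFunctor k L).map a.nabla.incl = (e c ⊗ₘ e c) ≫ Functor.LaxMonoidal.μ (bcFunctor k L) X X) ∧
      (∀ c, l c ≫ (bcFunctor k L).map a.α = (𝒥 c).diff ≫ (ι c).hom.hom.hom) := by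
  classical
  -- split `X` over a finite Galois `L / k`, with pointed pieces
  obtain ⟨L, _, _, _, _, C, _, E, e, hE, hP, ⟨hcol⟩⟩ :=
    exists_isGalois_isColimit_isSmoothProjective_algPoints (d := d) X hX
  haveI : Fintype C := Fintype.ofFinite C
  -- Albanese data of the pieces, along a `k`-embedding `L → ℂ`
  letI : Algebra L ℂ := ((IsAlgClosed.lift : L →ₐ[k] ℂ) : L →+* ℂ).toAlgebra
  have 𝒥 : ∀ c, Jacobian (E c) := fun c =>
    (nonempty_jacobian_of_isSmoothProjective_of_algebra_complex (hE c)).some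
  -- G1: Liu's datum of the split scheme `X_L`, `Alb = ⨁_c J(E_c)`, with the restrictions of `α` to the pieces
  obtain ⟨a'', π'', ι'', l'', ⟨hlim''⟩, hιπ, hιπ', htot, hl'', hα''⟩ :=
    hG1 hcol 𝒥 fun c => (hE c).geometricallyIrreducible
  -- descend `∇(X_L)` to `k`, over `(X × X)_L`
  obtain ⟨N, e', he'incl, he'⟩ := Nabla.exists_of_nabla_baseChange_incl L a''.nabla
  obtain ⟨h1, h2⟩ := Nabla.isReduced_bc_and_locallyOfFiniteType' L (d := d) N
  haveI := h1
  haveI := h2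
  -- G2: descend the datum, keeping both comparison isomorphisms and their compatibilities
  obtain ⟨a₀, n, i, -, -, hnincl, hnα⟩ := hG2 L N a'' e' he' he'incl
  -- G3: `a ≅ a₀` over `k`, compatibly with `∇` and `α`
  obtain ⟨e₃, φ, he₃incl, -, hφα⟩ := hG3 a a₀
  -- the assembly
  let θ : a.Alb.baseChange L ≅ a''.Alb := (AbelianVariety.baseChangeFunctor k L).mapIso φ ≪≫ i.symm
  have hθinv : θ.inv.hom.hom.hom = i.hom.hom.hom.hom ≫ (bcFunctor k L).map φ.inv.hom.hom.hom := by
    change (i.symm.inv ≫ ((AbelianVariety.baseChangeFunctor k L).mapIso φ).inv).hom.hom.hom = _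
    rfl
  have hφφ : φ.hom.hom.hom.hom ≫ φ.inv.hom.hom.hom = 𝟙 _ := by
    change (φ.hom ≫ φ.inv).hom.hom.hom = _
    rw [Iso.hom_inv_id]
    rfl
  have he₃α : e₃.inv ≫ a.α = a₀.α ≫ φ.inv.hom.hom.hom := by
    rw [Iso.inv_comp_eq, ← reassoc_of% hφα, hφφ, Category.comp_id]
  have he₃incl' : e₃.inv ≫ a.nabla.incl = a₀.nabla.incl := by
    rw [Iso.inv_comp_eq, he₃incl]
  refine ⟨L, inferInstance, inferInstance, inferInstance, inferInstance, C, inferInstance, E, e, hE, ⟨hcol⟩,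
    fun c => (hP c).some, 𝒥, fun c => θ.hom ≫ π'' c, fun c => ι'' c ≫ θ.inv,
    fun c => l'' c ≫ n.inv ≫ (bcFunctor k L).map e₃.inv, ⟨?_⟩, ?_, ?_, ?_, ?_, ?_⟩
  · -- the limit fan, transported along `θ`
    exact IsLimit.ofIsoLimit hlim'' (Fan.ext θ.symm fun c => (θ.inv_hom_id_assoc (π'' c)).symm)
  · intro c
    rw [Category.assoc, θ.inv_hom_id_assoc, hιπ]
  · intro c c' hcc'
    rw [Category.assoc, θ.inv_hom_id_assoc, hιπ' c c' hcc']
  · -- `∑ π ≫ ι = θ ≫ (∑ π″ ≫ ι″) ≫ θ⁻¹ = 𝟙`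
    have hre : ∀ c, (θ.hom ≫ π'' c) ≫ (ι'' c ≫ θ.inv) = θ.hom ≫ ((π'' c ≫ ι'' c) ≫ θ.inv) := fun c => by
      simp only [Category.assoc]
    change ∑ c, (θ.hom ≫ π'' c) ≫ (ι'' c ≫ θ.inv) = 𝟙 _
    rw [Finset.sum_congr rfl fun c _ => hre c, ← Preadditive.comp_sum, ← Preadditive.sum_comp, htot,
      Category.id_comp, θ.hom_inv_id]
  · -- compatibility with the inclusions into `(X × X)_L`
    intro c
    rw [Category.assoc, Category.assoc, ← Functor.map_comp, he₃incl', ← hnincl, n.inv_hom_id_assoc, ← Category.assoc,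
      hl'']
  · -- compatibility with the Albanese morphisms
    intro c
    rw [Category.assoc, Category.assoc, ← Functor.map_comp, he₃α, Functor.map_comp, ← hnα]
    simp only [Category.assoc, n.inv_hom_id_assoc]
    rw [reassoc_of% (hα'' c)]
    change _ = (𝒥 c).diff ≫ (ι'' c).hom.hom.hom ≫ θ.inv.hom.hom.hom
    rw [hθinv]

/-- **[Liu2021, §2.1, proof of the Proposition] The `α`-COMPATIBLE finite-Galois Albanese fan — «`(Alb_X)_{k'} = ∏ᵢ Alb_{Xᵢ}`»
WITH THE ALBANESE MORPHISMS MATCHED** (piece G4 of the III-0 (G)-road, cell `hodgecm-mathlib`; head = A-p18's carve §G4).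
For `X` smooth of relative dimension `d` and projective over a field `k` of characteristic zero with `[Algebra k ℂ]`, and ANY
`a : Albanese X` (Def. 2.3): a finite Galois `L / k`, a colimit cofan `e_c : E_c ⟶ X_L` of smooth projective pieces of
dimension `d` with rational points and Albanese data `𝒥_c` (Milne's difference-map form), a BIPRODUCT presentation
`π_c : Alb_X ×_k L ⟶ J(E_c)`, `ι_c : J(E_c) ⟶ Alb_X ×_k L` (limit fan; `ι_c ≫ π_c = 𝟙`, `ι_c ≫ π_{c'} = 0` for `c ≠ c'`,
`∑_c π_c ≫ ι_c = 𝟙`), and morphisms `l_c : E_c × E_c ⟶ (∇X)_L` lying over `e_c × e_c : E_c × E_c → X_L × X_L ≅ (X × X)_L`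
along which the base change `(α_X)_L` of the Albanese morphism is `diff_c ≫ ι_c` (the Albanese morphism of the piece
followed by its inclusion).  PROOF: split `X` over a finite Galois `L` with pointed pieces
(`exists_isGalois_isColimit_isSmoothProjective_algPoints`), Albanese data of the pieces along `L → ℂ`
(`nonempty_jacobian_of_isSmoothProjective_of_algebra_complex`), the split datum with its biproduct structure and `α|` exposed
(`Albanese.exists_of_isColimit_compat`, G1), descent of `∇` over `(X × X)_L` (`Nabla.exists_of_nabla_baseChange_incl`) and of
the datum with both comparison isomorphisms (`Albanese.exists_iso_baseChange_of_albanese_baseChange_compat_incl`, G2′),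
uniqueness with compatibilities (`Albanese.exists_iso_compat`, G3), assembled by
`θ := (φ_L) ≪≫ i⁻¹`, `π := θ ≫ π″`, `ι := ι″ ≫ θ⁻¹`, `l := l″ ≫ n⁻¹ ≫ (e₃⁻¹)_L`.  Ours.
[cite: Liu2021, §2.1 Proposition (FJcycle.tex l. 1190–1192) with proof (l. 1194–1200), Def. 2.3 (l. 1202–1208)]
[cite: Milne1986JacobianVarieties, Remark 1.9, §6 Prop. 6.4 and Remark 6.5] -/
theorem Albanese.exists_isGalois_isLimit_fan_baseChange_compat {k : Type} [Field k] [CharZero k] [Algebra k ℂ]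
    {d : ℕ} (X : SchemeOver k) [SmoothOfRelativeDimension d X.hom] (hX : IsProjectiveOver X) (a : Albanese X) :
    ∃ (L : Type) (_ : Field L) (_ : Algebra k L) (_ : FiniteDimensional k L) (_ : IsGalois k L)
      (C : Type) (_ : Fintype C) (E : C → SchemeOver L) (e : ∀ c, E c ⟶ (bcFunctor k L).obj X)
      (_ : ∀ c, IsSmoothProjective d (E c)) (_ : Nonempty (IsColimit (Cofan.mk ((bcFunctor k L).obj X) e)))
      (_ : ∀ c, AlgPoints (E c) L) (𝒥 : ∀ c, Jacobian (E c))
      (π : ∀ c, a.Alb.baseChange L ⟶ (𝒥 c).J) (ι : ∀ c, (𝒥 c).J ⟶ a.Alb.baseChange L)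
      (l : ∀ c, E c ⊗ E c ⟶ (bcFunctor k L).obj a.nabla.N),
      Nonempty (IsLimit (Fan.mk (a.Alb.baseChange L) π)) ∧ (∀ c, ι c ≫ π c = 𝟙 _) ∧ (∀ c c', c ≠ c' → ι c ≫ π c' = 0) ∧
      (∑ c, π c ≫ ι c = 𝟙 _) ∧
      (∀ c, l c ≫ (bcFunctor k L).map a.nabla.incl = (e c ⊗ₘ e c) ≫ Functor.LaxMonoidal.μ (bcFunctor k L) X X) ∧
      (∀ c, l c ≫ (bcFunctor k L).map a.α = (𝒥 c).diff ≫ (ι c).hom.hom.hom) :=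
  Albanese.exists_isGalois_isLimit_fan_baseChange_compat_of_inputs
    (by
      intro L _ X' κ _ Y inj hcol 𝒥 hirr
      exact Albanese.exists_of_isColimit_compat hcol 𝒥 hirr)
    (by
      intro k _ L _ _ _ _ X N _ _ a e he hei
      obtain ⟨a₀, n, i, h₁, h₂, h₃, h₄, -⟩ :=
        Albanese.exists_iso_baseChange_of_albanese_baseChange_compat_incl L N a e he hei
      exact ⟨a₀, n, i, h₁, h₂, h₃, h₄⟩)
    (by
      intro k _ X a₁ a₂
      exact Albanese.exists_iso_compat a₁ a₂)
    X hX a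

end Literature.NumberTheory.Automorphic.Liu2021.AppendixC

end
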